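import Literature.NumberTheory.Sieve.FriedlanderIwaniecPrimesLogSineKernel
import HarnessLib

/-!
# Friedlander–Iwaniec, *The polynomial `X² + Y⁴` captures its primes*, §16 (16.1)–(16.2), (16.6), (16.10):
# `U(β) = 2 Σ_{d ≤ X} φ(d)/d · U_d(β)`, the mollified `U_d`, and its separated truncated Fourier form

Source: J. Friedlander, H. Iwaniec, Ann. of Math. (2) 148 (1998), 945–1040 [FriedlanderIwaniecAnnals1998]
(= arXiv:math/9811185), §16 "Estimation of `U(β)`", pp. 58–59:

> "We write (16.1) `U(β) = 2 Σ_{d ≤ X} d⁻¹φ(d) U_d(β)` where (16.2)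
> `U_d(β) = ΣΣ_{(z₁,z₂)=1, Δ(z₁,z₂) ≡ 0 (mod 4d)} f(|Δ|/d) β_{z₁} β̄_{z₂} ((z₂/z₁)/d) log 2|z₁z₂/Δ|`. …
> by a trivial estimation we can remove the terms of (16.4) near the diagonal, say those with
> `|α₂ - α₁| < 2πH⁻¹` … This can be done smoothly by means of a function `h(α)` … We obtain (16.6)
> `U_d(β) = Σ_ω (ω/d) ΣΣ_{z₁ ≡ ω z₂ (mod 4d)} β_{z₁} β̄_{z₂} u(α₁ - α₂) + O(d⁻¹(P⁻¹ + H⁻¹)N²)` where (16.7)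
> `u(α) = -h(α) log ½|sin α|` … (16.9) `u(α) = Σ_{|k| ≤ K} û(k) e^{ikα} + O(K⁻¹H² log H)`. Inserting this in (16.4)
> we get (16.10) `U_d(β) = Σ_{|k| ≤ K} û(k) Σ_ω (ω/d) ΣΣ_{z₁ ≡ ω z₂ (mod 4d)} β_{z₁} β̄_{z₂} (z₁z̄₂/|z₁z₂|)^k + O(…)`."

In the tree's vocabulary (`…MainTermSplit`: `U(β) = fiU X S b = fiTwisted (fiCutU X) S b`, real weights `b`,
kernel `fiTKernel d = φ(d)/d · fiChi d · log(2·fiAbsProd/|fiDelta|)`, moduli `fiModuli` = `{d ≥ 1 : 4d ∣ Δ}`,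
cut `fiTenF X (|Δ|/d)`), this file PROVES:

* `fiUd X d S b` — the block `U_d(β)` of (16.2) (the rational-class symbol `((z₂/z₁)/d)` is the tree's
  `fiChi d z₁ z₂`; the detection of `4d ∣ Δ` by the classes `ω` and the characters, (16.3)–(16.4)/(16.11), is
  `…CharacterDetection` and is not repeated), and **(16.1)** `fiU_eq_sum_fiUd : U(β) = 2 Σ_{1 ≤ d ≤ X} φ(d)/d · U_d(β)`;
* `fiUdMoll X H d S b` — the main term of (16.6): `U_d` with `log 2|z₁z₂/Δ|` replaced by the mollified
  `u_H(α₁ - α₂)` (`logSineMollifier H`, smooth cutoff, `…LogSineMollifier`), and the **pointwise cost of (16.6)**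
  `abs_fiUd_sub_fiUdMoll_le`: `|U_d - U_d^{(H)}| ≤ ΣΣ_{(z₁,z₂)=1, 4d∣Δ, |z₁z₂| > H|Δ|} f(|Δ|/d) |b_{z₁}b_{z₂}| log(2|z₁z₂|)`
  (only the near-diagonal pairs `|sin(α₂ - α₁)| < 1/H` remain; the lattice-point count turning this into
  `O(d⁻¹H⁻¹N²)` is not part of this file);
* `fiSd X d S b k` — the separated double sum `ΣΣ f(|Δ|/d) b_{z₁} b_{z₂} χ_d(z₂/z₁) (z₁z̄₂/|z₁z₂|)^k` of (16.10)
  (before the character detection (16.11)), and **(16.9) ⇒ (16.10)** `exists_fiUdMoll_trunc`: with the Fourier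
  coefficients `û_H` of `exists_logSineMollifier_separation`,
  `|U_d^{(H)} - Σ_{|k| ≤ K} û_H(k) S_d(k)| ≤ C·H·log(4H)·K⁻¹ · ΣΣ f |b_{z₁} b_{z₂}|` for all `X, d, S, b`, `K ≥ 1`,
  one `û_H` for all of them (`Σ_k |û_H(k)| ≤ C log²(4H)`, `|û_H(k)| ≤ log 4H`).

No named facts, no `sorry`.

## References
* J. Friedlander, H. Iwaniec, Ann. of Math. (2) 148 (1998), 945–1040, §16 (16.1)–(16.2), (16.6)–(16.10).
  [FriedlanderIwaniecAnnals1998]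

## Tree / Mathlib
Tree: `fiU`, `fiTwisted`, `fiCutU`, `fiTenF`, `fiTenF_mem_Icc`, `fiTKernel`, `fiModuli`, `fiDelta`, `fiAbsProd`,
`fiChi`, `GaussCoprime` (`…MainTermSplit`, `…CoprimeCount`), `gaussArg`; `abs_log_kernel_sub_mollifier_le`,
`abs_fiDelta_le_fiAbsProd`, `fiAbsProd_eq_norm_mul` (`…LogSineKernel`); `exists_logSineMollifier_separation`,
`exp_int_mul_arg_sub_mul_I` (`…LogSineSeparation`). Mathlib: `Finset.sum_comm`, `Finset.sum_filter`,
`Finset.sum_product`, `Nat.le_floor_iff'`, `jacobiSym.trichotomy`.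
-/

noncomputable section

open Real Complex Finset
open scoped ComplexConjugate NumberTheorySymbols

namespace Literature.NumberTheory.Sieve.FriedlanderIwaniecPrimes

/-! ### (16.2): the block `U_d(β)` and (16.1) -/

/-- **(16.2)** `U_d(β) = ΣΣ_{(z₁,z₂)=1, 4d ∣ Δ(z₁,z₂)} f(|Δ|/d) β_{z₁} β_{z₂} ((z₂/z₁)/d) log 2|z₁z₂/Δ|` (real weights;
`d ∈ fiModuli z₁ z₂` encodes `d ≥ 1`, `4d ∣ Δ ≠ 0`). [cite: FriedlanderIwaniecAnnals1998, (16.2)] -/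
def fiUd (X : ℝ) (d : ℕ) (S : Finset GaussianInt) (b : GaussianInt → ℝ) : ℝ :=
  ∑ z₁ ∈ S, ∑ z₂ ∈ S,
    if GaussCoprime z₁ z₂ ∧ d ∈ fiModuli z₁ z₂ then
      fiTenF X (|(fiDelta z₁ z₂ : ℝ)| / d) * (b z₁ * b z₂) * (fiChi d z₁ z₂ : ℝ) *
        Real.log (2 * fiAbsProd z₁ z₂ / |(fiDelta z₁ z₂ : ℝ)|)
    else 0

/-- Members of `fiModuli z₁ z₂` are `≥ 1` and force `Δ ≠ 0`. [folklore] -/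
private theorem ud_of_mem_fiModuli {z₁ z₂ : GaussianInt} {d : ℕ} (hd : d ∈ fiModuli z₁ z₂) :
    1 ≤ d ∧ fiDelta z₁ z₂ ≠ 0 := by
  unfold fiModuli at hd
  rw [mem_filter, Nat.mem_divisors] at hd
  refine ⟨Nat.pos_of_ne_zero fun h0 => ?_, fun h0 => hd.1.2 (by rw [h0]; rfl)⟩
  rw [h0] at hd; exact hd.1.2 (Nat.eq_zero_of_zero_dvd hd.1.1)

/-- The `d`-sum of `U(β)` for one pair, moved to the fixed range `1 ≤ d ≤ ⌊X⌋`. [folklore] -/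
private theorem ud_inner_eq (X : ℝ) (z₁ z₂ : GaussianInt) (c : ℕ → ℝ) :
    ∑ d ∈ fiModuli z₁ z₂, fiCutU X d (|(fiDelta z₁ z₂ : ℝ)| / d) * c d =
      ∑ d ∈ Icc 1 ⌊X⌋₊, if d ∈ fiModuli z₁ z₂ then fiTenF X (|(fiDelta z₁ z₂ : ℝ)| / d) * c d else 0 := by
  have h1 : ∑ d ∈ fiModuli z₁ z₂, fiCutU X d (|(fiDelta z₁ z₂ : ℝ)| / d) * c d =
      ∑ d ∈ (fiModuli z₁ z₂).filter (fun d : ℕ => (d : ℝ) ≤ X), fiTenF X (|(fiDelta z₁ z₂ : ℝ)| / d) * c d := by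
    rw [sum_filter]
    refine sum_congr rfl fun d _ => ?_
    unfold fiCutU
    split_ifs <;> simp
  have h2 : (fiModuli z₁ z₂).filter (fun d : ℕ => (d : ℝ) ≤ X) = (Icc 1 ⌊X⌋₊).filter (fun d => d ∈ fiModuli z₁ z₂) := by
    ext d
    simp only [mem_filter, mem_Icc]
    constructor
    · rintro ⟨hd, hX⟩
      have h1d := (ud_of_mem_fiModuli hd).1
      exact ⟨⟨h1d, (Nat.le_floor_iff' (by omega)).2 hX⟩, hd⟩
    · rintro ⟨⟨h1d, hX⟩, hd⟩
      exact ⟨hd, (Nat.le_floor_iff' (by omega)).1 hX⟩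
  rw [h1, h2, sum_filter]

/-- (16.1) for one pair: the `d`-sum of `U(β)` against the blocks' integrands. [folklore] -/
private theorem ud_pair_eq (X : ℝ) (b : GaussianInt → ℝ) (z₁ z₂ : GaussianInt) :
    (if GaussCoprime z₁ z₂ then
        b z₁ * b z₂ * ∑ d ∈ fiModuli z₁ z₂, fiCutU X d (|(fiDelta z₁ z₂ : ℝ)| / d) * fiTKernel d z₁ z₂
      else 0) =
      ∑ d ∈ Icc 1 ⌊X⌋₊, ((d.totient : ℝ) / d) *
        (if GaussCoprime z₁ z₂ ∧ d ∈ fiModuli z₁ z₂ then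
          fiTenF X (|(fiDelta z₁ z₂ : ℝ)| / d) * (b z₁ * b z₂) * (fiChi d z₁ z₂ : ℝ) *
            Real.log (2 * fiAbsProd z₁ z₂ / |(fiDelta z₁ z₂ : ℝ)|)
        else 0) := by
  by_cases hc : GaussCoprime z₁ z₂
  · rw [if_pos hc, ud_inner_eq X z₁ z₂ (fun d => fiTKernel d z₁ z₂), Finset.mul_sum]
    refine sum_congr rfl fun d _ => ?_
    by_cases hd : d ∈ fiModuli z₁ z₂
    · rw [if_pos hd, if_pos ⟨hc, hd⟩]; unfold fiTKernel; ring
    · rw [if_neg hd, if_neg (fun h => hd h.2)]; ring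
  · rw [if_neg hc]
    symm
    exact sum_eq_zero fun d _ => by rw [if_neg (fun h => hc h.1), mul_zero]

/-- **(16.1)**: `U(β) = 2 Σ_{1 ≤ d ≤ X} φ(d)/d · U_d(β)`. [cite: FriedlanderIwaniecAnnals1998, (16.1)] -/
theorem fiU_eq_sum_fiUd (X : ℝ) (S : Finset GaussianInt) (b : GaussianInt → ℝ) :
    fiU X S b = 2 * ∑ d ∈ Icc 1 ⌊X⌋₊, ((d.totient : ℝ) / d) * fiUd X d S b := by
  unfold fiU fiTwisted fiUd
  congr 1
  simp only [ud_pair_eq X b]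
  have e1 : ∀ z₁ ∈ S,
      (∑ z₂ ∈ S, ∑ d ∈ Icc 1 ⌊X⌋₊, ((d.totient : ℝ) / d) *
        (if GaussCoprime z₁ z₂ ∧ d ∈ fiModuli z₁ z₂ then
          fiTenF X (|(fiDelta z₁ z₂ : ℝ)| / d) * (b z₁ * b z₂) * (fiChi d z₁ z₂ : ℝ) *
            Real.log (2 * fiAbsProd z₁ z₂ / |(fiDelta z₁ z₂ : ℝ)|)
        else 0)) =
      ∑ d ∈ Icc 1 ⌊X⌋₊, ∑ z₂ ∈ S, ((d.totient : ℝ) / d) *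
        (if GaussCoprime z₁ z₂ ∧ d ∈ fiModuli z₁ z₂ then
          fiTenF X (|(fiDelta z₁ z₂ : ℝ)| / d) * (b z₁ * b z₂) * (fiChi d z₁ z₂ : ℝ) *
            Real.log (2 * fiAbsProd z₁ z₂ / |(fiDelta z₁ z₂ : ℝ)|)
        else 0) := fun z₁ _ => Finset.sum_comm
  rw [sum_congr rfl e1, Finset.sum_comm]
  refine sum_congr rfl fun d _ => ?_
  rw [Finset.mul_sum]
  refine sum_congr rfl fun z₁ _ => ?_
  rw [Finset.mul_sum]

/-! ### (16.6): the mollified block and the pointwise cost of mollifying -/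

/-- The main term of **(16.6)**: `U_d^{(H)}(β) = ΣΣ_{(z₁,z₂)=1, 4d∣Δ} f(|Δ|/d) β_{z₁} β_{z₂} ((z₂/z₁)/d) u_H(α₁ - α₂)`,
the block `U_d` with the logarithm mollified (`u_H = logSineMollifier H`, `α_j = arg z_j`).
[cite: FriedlanderIwaniecAnnals1998, (16.6)–(16.7)] -/
def fiUdMoll (X H : ℝ) (d : ℕ) (S : Finset GaussianInt) (b : GaussianInt → ℝ) : ℝ :=
  ∑ z₁ ∈ S, ∑ z₂ ∈ S,
    if GaussCoprime z₁ z₂ ∧ d ∈ fiModuli z₁ z₂ then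
      fiTenF X (|(fiDelta z₁ z₂ : ℝ)| / d) * (b z₁ * b z₂) * (fiChi d z₁ z₂ : ℝ) *
        logSineMollifier H (gaussArg z₁ - gaussArg z₂)
    else 0

/-- `|χ_d(z₂/z₁)| ≤ 1` (a Jacobi symbol). [folklore] -/
private theorem ud_abs_fiChi_le (d : ℕ) (z₁ z₂ : GaussianInt) : |(fiChi d z₁ z₂ : ℝ)| ≤ 1 := by
  unfold fiChi
  rcases jacobiSym.trichotomy (ratioClass (4 * d) z₂ z₁) (d / 2 ^ d.factorization 2) with h | h | h <;>
    rw [h] <;> norm_num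

/-- **The cost of (16.6), pointwise**: `|U_d(β) - U_d^{(H)}(β)| ≤ ΣΣ_{(z₁,z₂)=1, 4d∣Δ, |z₁z₂| > H|Δ|} f(|Δ|/d) |β_{z₁}β_{z₂}| log(2|z₁z₂|)`
(`H > 0`): only the near-diagonal pairs (`|sin(α₂ - α₁)| < 1/H`) contribute, each at most its trivial size.
[cite: FriedlanderIwaniecAnnals1998, (16.6) ("by a trivial estimation we can remove the terms … near the diagonal … at the cost of `O(d⁻¹H⁻¹N²)`")] -/
theorem abs_fiUd_sub_fiUdMoll_le {H : ℝ} (hH : 0 < H) (X : ℝ) (d : ℕ) (S : Finset GaussianInt)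
    (b : GaussianInt → ℝ) :
    |fiUd X d S b - fiUdMoll X H d S b| ≤
      ∑ z₁ ∈ S, ∑ z₂ ∈ S,
        if GaussCoprime z₁ z₂ ∧ d ∈ fiModuli z₁ z₂ ∧ H * |(fiDelta z₁ z₂ : ℝ)| < fiAbsProd z₁ z₂ then
          fiTenF X (|(fiDelta z₁ z₂ : ℝ)| / d) * |b z₁ * b z₂| * Real.log (2 * fiAbsProd z₁ z₂)
        else 0 := by
  unfold fiUd fiUdMoll
  rw [← sum_sub_distrib]
  refine (abs_sum_le_sum_abs _ _).trans (sum_le_sum fun z₁ _ => ?_)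
  rw [← sum_sub_distrib]
  refine (abs_sum_le_sum_abs _ _).trans (sum_le_sum fun z₂ _ => ?_)
  by_cases hc : GaussCoprime z₁ z₂ ∧ d ∈ fiModuli z₁ z₂
  · rw [if_pos hc, if_pos hc, ← mul_sub, abs_mul, abs_mul, abs_mul]
    have hΔ := (ud_of_mem_fiModuli hc.2).2
    have hf := fiTenF_mem_Icc X (|(fiDelta z₁ z₂ : ℝ)| / d)
    rw [abs_of_nonneg hf.1]
    have hker := abs_log_kernel_sub_mollifier_le hH hΔ (z₁ := z₁) (z₂ := z₂)
    rw [← logSineMollifier_neg, neg_sub] at hker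
    by_cases hfar : fiAbsProd z₁ z₂ ≤ H * |((fiDelta z₁ z₂ : ℤ) : ℝ)|
    · rw [if_pos hfar] at hker
      rw [if_neg (fun h => (not_lt.mpr hfar) h.2.2)]
      have : |Real.log (2 * fiAbsProd z₁ z₂ / |(fiDelta z₁ z₂ : ℝ)|) -
          logSineMollifier H (gaussArg z₁ - gaussArg z₂)| = 0 := le_antisymm hker (abs_nonneg _)
      rw [this, mul_zero]
    · rw [if_neg hfar] at hker
      rw [if_pos ⟨hc.1, hc.2, not_le.mp hfar⟩]
      have h1 : fiTenF X (|(fiDelta z₁ z₂ : ℝ)| / d) * |b z₁ * b z₂| * |(fiChi d z₁ z₂ : ℝ)| ≤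
          fiTenF X (|(fiDelta z₁ z₂ : ℝ)| / d) * |b z₁ * b z₂| * 1 :=
        mul_le_mul_of_nonneg_left (ud_abs_fiChi_le d z₁ z₂) (mul_nonneg hf.1 (abs_nonneg _))
      calc fiTenF X (|(fiDelta z₁ z₂ : ℝ)| / d) * |b z₁ * b z₂| * |(fiChi d z₁ z₂ : ℝ)| *
            |Real.log (2 * fiAbsProd z₁ z₂ / |(fiDelta z₁ z₂ : ℝ)|) - logSineMollifier H (gaussArg z₁ - gaussArg z₂)|
          ≤ fiTenF X (|(fiDelta z₁ z₂ : ℝ)| / d) * |b z₁ * b z₂| * 1 * Real.log (2 * fiAbsProd z₁ z₂) :=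
            mul_le_mul h1 hker (abs_nonneg _) (mul_nonneg (mul_nonneg hf.1 (abs_nonneg _)) zero_le_one)
        _ = _ := by rw [mul_one]
  · rw [if_neg hc, if_neg hc, if_neg (fun h => hc ⟨h.1, h.2.1⟩), sub_zero, abs_zero]

/-! ### (16.10): the separated, truncated Fourier form of the mollified block -/

/-- The weight of the pair `(z₁, z₂)` in `U_d`: `f(|Δ|/d) β_{z₁} β_{z₂} ((z₂/z₁)/d)` on admissible pairs, else `0`.
[cite: FriedlanderIwaniecAnnals1998, (16.2)/(16.10)] -/
def fiUdWeight (X : ℝ) (d : ℕ) (b : GaussianInt → ℝ) (z₁ z₂ : GaussianInt) : ℝ :=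
  if GaussCoprime z₁ z₂ ∧ d ∈ fiModuli z₁ z₂ then
    fiTenF X (|(fiDelta z₁ z₂ : ℝ)| / d) * (b z₁ * b z₂) * (fiChi d z₁ z₂ : ℝ)
  else 0

/-- The separated double sum of **(16.10)** (before the character detection (16.11)):
`S_d(k) = ΣΣ f(|Δ|/d) β_{z₁} β_{z₂} ((z₂/z₁)/d) · (z₁z̄₂/|z₁z₂|)^k`. [cite: FriedlanderIwaniecAnnals1998, (16.10)] -/
def fiSd (X : ℝ) (d : ℕ) (S : Finset GaussianInt) (b : GaussianInt → ℝ) (k : ℤ) : ℂ :=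
  ∑ z₁ ∈ S, ∑ z₂ ∈ S, (fiUdWeight X d b z₁ z₂ : ℂ) *
    (GaussianInt.toComplex z₁ * conj (GaussianInt.toComplex z₂) /
      ((‖GaussianInt.toComplex z₁‖ * ‖GaussianInt.toComplex z₂‖ : ℝ) : ℂ)) ^ k

/-- `U_d^{(H)}` as a weighted sum of `u_H(α₁ - α₂)` over the pairs, in `ℂ`. [folklore] -/
private theorem ud_fiUdMoll_eq_sum_pairs (X H : ℝ) (d : ℕ) (S : Finset GaussianInt) (b : GaussianInt → ℝ) :
    (fiUdMoll X H d S b : ℂ) =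
      ∑ i ∈ S ×ˢ S, (fiUdWeight X d b i.1 i.2 : ℂ) *
        ((logSineMollifier H (gaussArg i.1 - gaussArg i.2) : ℝ) : ℂ) := by
  unfold fiUdMoll fiUdWeight
  push_cast
  rw [Finset.sum_product]
  refine sum_congr rfl fun z₁ _ => sum_congr rfl fun z₂ _ => ?_
  split_ifs <;> push_cast <;> ring

/-- The harmonics of `S_d(k)`: on admissible pairs `e^{ik(α₁ - α₂)} = (z₁z̄₂/|z₁z₂|)^k`; elsewhere the weight
vanishes. [folklore] -/
private theorem ud_fiSd_eq_sum_pairs (X : ℝ) (d : ℕ) (S : Finset GaussianInt) (b : GaussianInt → ℝ) (k : ℤ) :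
    fiSd X d S b k =
      ∑ i ∈ S ×ˢ S, (fiUdWeight X d b i.1 i.2 : ℂ) *
        Complex.exp (k * ((gaussArg i.1 - gaussArg i.2 : ℝ) : ℝ) * I) := by
  unfold fiSd
  rw [Finset.sum_product]
  refine sum_congr rfl fun z₁ _ => sum_congr rfl fun z₂ _ => ?_
  by_cases hc : GaussCoprime z₁ z₂ ∧ d ∈ fiModuli z₁ z₂
  · have hΔ := (ud_of_mem_fiModuli hc.2).2
    have hA : 0 < fiAbsProd z₁ z₂ := lt_of_lt_of_le (abs_pos.mpr (by exact_mod_cast hΔ)) (abs_fiDelta_le_fiAbsProd z₁ z₂)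
    rw [fiAbsProd_eq_norm_mul] at hA
    have hz₁ : GaussianInt.toComplex z₁ ≠ 0 := by
      intro h; rw [h, norm_zero, zero_mul] at hA; exact lt_irrefl _ hA
    have hz₂ : GaussianInt.toComplex z₂ ≠ 0 := by
      intro h; rw [h, norm_zero, mul_zero] at hA; exact lt_irrefl _ hA
    congr 1
    unfold gaussArg
    exact (exp_int_mul_arg_sub_mul_I hz₁ hz₂ k).symm
  · simp only [fiUdWeight, if_neg hc]; push_cast; rw [zero_mul, zero_mul]

/-- **(16.9) ⇒ (16.10), with the cost made explicit.**  There is an absolute `C > 0` and, for every `H ≥ 2`, ONE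
sequence `û_H : ℤ → ℂ` (`|û_H(k)| ≤ log 4H`, `Σ_k |û_H(k)| ≤ C log²(4H)`) such that for all `X`, `d`, all finite
supports `S` and real weights `β`, and every `K ≥ 1`:
`|U_d^{(H)}(β) - Σ_{|k| ≤ K} û_H(k) S_d(k)| ≤ C·H·log(4H)·K⁻¹ · ΣΣ |f(|Δ|/d) β_{z₁} β_{z₂} ((z₂/z₁)/d)|`
(printed: `+ O(d⁻¹ K⁻¹H² log H · N²)` after the trivial bound for the double sum).
[cite: FriedlanderIwaniecAnnals1998, (16.9)–(16.10)] -/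
theorem exists_fiUdMoll_trunc : ∃ C : ℝ, 0 < C ∧ ∀ H : ℝ, 2 ≤ H →
    ∃ c : ℤ → ℂ, (∀ k, ‖c k‖ ≤ Real.log (4 * H)) ∧ (Summable fun k => ‖c k‖) ∧
      (∑' k : ℤ, ‖c k‖ ≤ C * Real.log (4 * H) ^ 2) ∧
      ∀ (X : ℝ) (d : ℕ) (S : Finset GaussianInt) (b : GaussianInt → ℝ) (K : ℕ), 1 ≤ K →
        ‖(fiUdMoll X H d S b : ℂ) - ∑ k ∈ Finset.Icc (-(K : ℤ)) K, c k * fiSd X d S b k‖ ≤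
          C * H * Real.log (4 * H) / K * ∑ i ∈ S ×ˢ S, |fiUdWeight X d b i.1 i.2| := by
  obtain ⟨C, hC, hmain⟩ := exists_logSineMollifier_separation.{0}
  refine ⟨C, hC, fun H hH => ?_⟩
  obtain ⟨c, hc0, hsum, htsum, -, -, htrunc⟩ := hmain H hH
  refine ⟨c, hc0, hsum, htsum, fun X d S b K hK => ?_⟩
  have h := htrunc (GaussianInt × GaussianInt) (S ×ˢ S) (fun i => (fiUdWeight X d b i.1 i.2 : ℂ))
    (fun i => gaussArg i.1 - gaussArg i.2) K hK
  rw [ud_fiUdMoll_eq_sum_pairs]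
  have hS : ∀ k : ℤ, fiSd X d S b k = ∑ i ∈ S ×ˢ S, (fiUdWeight X d b i.1 i.2 : ℂ) *
      Complex.exp (k * ((gaussArg i.1 - gaussArg i.2 : ℝ) : ℝ) * I) := ud_fiSd_eq_sum_pairs X d S b
  simp_rw [hS]
  have hn : ∀ i : GaussianInt × GaussianInt, ‖(fiUdWeight X d b i.1 i.2 : ℂ)‖ = |fiUdWeight X d b i.1 i.2| :=
    fun i => by rw [Complex.norm_real, Real.norm_eq_abs]
  simp_rw [hn] at h
  convert h using 3

end Literature.NumberTheory.Sieve.FriedlanderIwaniecPrimes
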